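import Summits.Ventures.PercRepro.C025ProfilePLDSolidLiftArith

/-!
# THE SOLID LIFT WITH THE SMALL PRESERVERS q₄ⁿ = T₁₄ + 2·T₂₄ + 3·T₃₄ AND q₄ⁿ′ = T₂₄ + 2·T₃₄ (night-3 g32)

`proofs/NIGHT3-G32-MATCHING.md` §6.  The joint LP of kit j314645 finds the minimal-coefficient preservers of the shape
`T₁₄ + β·T₂₄ + γ·T₃₄` to be `(1, 2, 8/3)` at rank ≤ 6 and ≤ 7, and `T₂₄ + 2·T₃₄` at rank ≤ 7; rounded up they are preservers at
rank ≤ 7 (certificate tables).  With them the lift of g31 (`PLDSolidLift.lift_instance_solid`, preservers `6T₁₄ + 39T₂₄ + 107T₃₄`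
and `T₂₄ + 3T₃₄`) becomes `6·(U_{4,7+k} − U_{4,7}) = 6k·q₄ⁿ + 3k(9+k)·q₄ⁿ′ + k(k² + 12k + 35)·T₃₄ + 6(c_{7+k} − c₇)·δ₄₄`
(`lift_alg_solid_small`, `lift_instance_solid_small`), reusing g31's eleven-layer expansion and binomial identities.
No `def`, no `instance`, no notation.  Axioms: standard.
-/

namespace PercRepro

open Finset

namespace PLDSolidLiftSmall

variable {ι : Type}

/-- The linear algebra of the solid lift from `m₀ = 7`, with the eighteen layer sums and the coefficients abstracted:
`6·C₂ = 126 + 39k + 3k²`, `6·C₃ = 210 + 107k + 18k² + k³` (`C₂ = C(7+k, 2)`, `C₃ = C(7+k, 3)`), with the SMALL preservers. -/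
theorem lift_alg_solid_small (a04 a14 a24 a34 a44 a43 a42 a41 a40 b04 b14 b24 b34 b44 b43 b42 b41 b40 k k' C2 C3 c₀ : ℕ)
    (hC2 : 6 * C2 = 126 + 39 * k + 3 * k * k) (hC3 : 6 * C3 = 210 + 107 * k + 18 * k * k + k * k * k)
    (h₀ : a04 + 7 * a14 + 21 * a24 + 35 * a34 + c₀ * a44 + 35 * a43 + 21 * a42 + 7 * a41 + a40 ≤
      b04 + 7 * b14 + 21 * b24 + 35 * b34 + c₀ * b44 + 35 * b43 + 21 * b42 + 7 * b41 + b40)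
    (hq : (a14 + a41) + 2 * (a24 + a42) + 3 * (a34 + a43) ≤ (b14 + b41) + 2 * (b24 + b42) + 3 * (b34 + b43))
    (hq' : (a24 + a42) + 2 * (a34 + a43) ≤ (b24 + b42) + 2 * (b34 + b43))
    (hT : a34 + a43 ≤ b34 + b43) (hS : a44 ≤ b44) :
    a04 + (7 + k) * a14 + C2 * a24 + C3 * a34 + (c₀ + k') * a44 + C3 * a43 + C2 * a42 + (7 + k) * a41 + a40 ≤
      b04 + (7 + k) * b14 + C2 * b24 + C3 * b34 + (c₀ + k') * b44 + C3 * b43 + C2 * b42 + (7 + k) * b41 + b40 := by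
  have e1 : 6 * C2 * a24 = (126 + 39 * k + 3 * k * k) * a24 := by rw [hC2]
  have e2 : 6 * C2 * a42 = (126 + 39 * k + 3 * k * k) * a42 := by rw [hC2]
  have e3 : 6 * C2 * b24 = (126 + 39 * k + 3 * k * k) * b24 := by rw [hC2]
  have e4 : 6 * C2 * b42 = (126 + 39 * k + 3 * k * k) * b42 := by rw [hC2]
  have f1 : 6 * C3 * a34 = (210 + 107 * k + 18 * k * k + k * k * k) * a34 := by rw [hC3]
  have f2 : 6 * C3 * a43 = (210 + 107 * k + 18 * k * k + k * k * k) * a43 := by rw [hC3]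
  have f3 : 6 * C3 * b34 = (210 + 107 * k + 18 * k * k + k * k * k) * b34 := by rw [hC3]
  have f4 : 6 * C3 * b43 = (210 + 107 * k + 18 * k * k + k * k * k) * b43 := by rw [hC3]
  have hqk := Nat.mul_le_mul_left (6 * k) hq
  have hq'k := Nat.mul_le_mul_left (3 * k * (9 + k)) hq'
  have hTk := Nat.mul_le_mul_left (k * (k * k + 12 * k + 35)) hT
  have hSk := Nat.mul_le_mul_left (6 * k') hS
  linarith [e1, e2, e3, e4, f1, f2, f3, f4, hqk, hq'k, hTk, hSk, h₀]

set_option maxHeartbeats 400000 in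
/-- THE LIFT IN `m` FOR SOLIDS from `m₀ = 7`: for a family `(s, x, f)` with (PLD), `7 ≤ m`, an admissible `(lo, hi, δ, Θ)`, the
`q₄`-instance (`6·T₁₄ + 39·T₂₄ + 107·T₃₄`), the `q₄′`-instance (`T₂₄ + 3·T₃₄`) and the `U_{4,7}`-instance give the `U_{4,m}`-instance. -/
theorem lift_instance_solid_small (s : Finset ι) (x f : ι → ℕ)
    (hPLD : ∀ lo hi δ Θ : ℕ, Θ ≤ lo + hi + δ → (lo = 0 ∨ lo + hi + δ ≤ Θ) →
      ∑ i ∈ s, (if lo ≤ x i ∧ x i ≤ hi ∧ Θ ≤ f i + x i then (f i).choose δ else 0) ≤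
        ∑ i ∈ s, (if lo + δ ≤ f i ∧ f i ≤ hi + δ then (f i).choose δ else 0))
    (m : ℕ) (hm : 7 ≤ m) (lo hi δ Θ : ℕ) (hΘ : Θ ≤ lo + hi + δ) (hlo : lo = 0 ∨ lo + hi + δ ≤ Θ)
    (hq : ∑ i ∈ s, (((if lo ≤ x i + 1 ∧ x i + 1 ≤ hi ∧ Θ ≤ (f i + 4) + (x i + 1) then (f i + 4).choose δ else 0) + (if lo ≤ x i + 4 ∧ x i + 4 ≤ hi ∧ Θ ≤ (f i + 1) + (x i + 4) then (f i + 1).choose δ else 0)) + 2 * ((if lo ≤ x i + 2 ∧ x i + 2 ≤ hi ∧ Θ ≤ (f i + 4) + (x i + 2) then (f i + 4).choose δ else 0) + (if lo ≤ x i + 4 ∧ x i + 4 ≤ hi ∧ Θ ≤ (f i + 2) + (x i + 4) then (f i + 2).choose δ else 0)) + 3 * ((if lo ≤ x i + 3 ∧ x i + 3 ≤ hi ∧ Θ ≤ (f i + 4) + (x i + 3) then (f i + 4).choose δ else 0) + (if lo ≤ x i + 4 ∧ x i + 4 ≤ hi ∧ Θ ≤ (f i + 3) + (x i + 4) then (f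 i + 3).choose δ else 0))) ≤
      ∑ i ∈ s, (((if lo + δ ≤ f i + 4 ∧ f i + 4 ≤ hi + δ then (f i + 4).choose δ else 0) + (if lo + δ ≤ f i + 1 ∧ f i + 1 ≤ hi + δ then (f i + 1).choose δ else 0)) + 2 * ((if lo + δ ≤ f i + 4 ∧ f i + 4 ≤ hi + δ then (f i + 4).choose δ else 0) + (if lo + δ ≤ f i + 2 ∧ f i + 2 ≤ hi + δ then (f i + 2).choose δ else 0)) + 3 * ((if lo + δ ≤ f i + 4 ∧ f i + 4 ≤ hi + δ then (f i + 4).choose δ else 0) + (if lo + δ ≤ f i + 3 ∧ f i + 3 ≤ hi + δ then (f i + 3).choose δ else 0))))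
    (hq' : ∑ i ∈ s, (((if lo ≤ x i + 2 ∧ x i + 2 ≤ hi ∧ Θ ≤ (f i + 4) + (x i + 2) then (f i + 4).choose δ else 0) + (if lo ≤ x i + 4 ∧ x i + 4 ≤ hi ∧ Θ ≤ (f i + 2) + (x i + 4) then (f i + 2).choose δ else 0)) + 2 * ((if lo ≤ x i + 3 ∧ x i + 3 ≤ hi ∧ Θ ≤ (f i + 4) + (x i + 3) then (f i + 4).choose δ else 0) + (if lo ≤ x i + 4 ∧ x i + 4 ≤ hi ∧ Θ ≤ (f i + 3) + (x i + 4) then (f i + 3).choose δ else 0))) ≤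
      ∑ i ∈ s, (((if lo + δ ≤ f i + 4 ∧ f i + 4 ≤ hi + δ then (f i + 4).choose δ else 0) + (if lo + δ ≤ f i + 2 ∧ f i + 2 ≤ hi + δ then (f i + 2).choose δ else 0)) + 2 * ((if lo + δ ≤ f i + 4 ∧ f i + 4 ≤ hi + δ then (f i + 4).choose δ else 0) + (if lo + δ ≤ f i + 3 ∧ f i + 3 ≤ hi + δ then (f i + 3).choose δ else 0))))
    (h₀ : ∑ i ∈ s, ∑ j ∈ range (7 + 1), Nat.choose 7 j *
        (if lo ≤ x i + min j 4 ∧ x i + min j 4 ≤ hi ∧ Θ ≤ (f i + min (7 - j) 4) + (x i + min j 4) then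
          (f i + min (7 - j) 4).choose δ else 0) ≤
      ∑ i ∈ s, ∑ j ∈ range (7 + 1), Nat.choose 7 j *
        (if lo + δ ≤ f i + min (7 - j) 4 ∧ f i + min (7 - j) 4 ≤ hi + δ then (f i + min (7 - j) 4).choose δ else 0)) :
    ∑ i ∈ s, ∑ j ∈ range (m + 1), Nat.choose m j *
        (if lo ≤ x i + min j 4 ∧ x i + min j 4 ≤ hi ∧ Θ ≤ (f i + min (m - j) 4) + (x i + min j 4) then
          (f i + min (m - j) 4).choose δ else 0) ≤
      ∑ i ∈ s, ∑ j ∈ range (m + 1), Nat.choose m j *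
        (if lo + δ ≤ f i + min (m - j) 4 ∧ f i + min (m - j) 4 ≤ hi + δ then (f i + min (m - j) 4).choose δ else 0) := by
  -- the preservers `T₃₄` and `δ₄₄`
  have h11 : ∀ lo hi δ Θ : ℕ, Θ ≤ lo + hi + δ → (lo = 0 ∨ lo + hi + δ ≤ Θ) →
      ∑ i ∈ s, (if lo ≤ x i + 1 ∧ x i + 1 ≤ hi ∧ Θ ≤ (f i + 1) + (x i + 1) then (f i + 1).choose δ else 0) ≤
        ∑ i ∈ s, (if lo + δ ≤ f i + 1 ∧ f i + 1 ≤ hi + δ then (f i + 1).choose δ else 0) :=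
    fun lo hi δ Θ h1 h2 => PLDClosure.shift11 s x f hPLD lo hi δ Θ h1 h2
  have h22 : ∀ lo hi δ Θ : ℕ, Θ ≤ lo + hi + δ → (lo = 0 ∨ lo + hi + δ ≤ Θ) →
      ∑ i ∈ s, (if lo ≤ x i + 2 ∧ x i + 2 ≤ hi ∧ Θ ≤ (f i + 2) + (x i + 2) then (f i + 2).choose δ else 0) ≤
        ∑ i ∈ s, (if lo + δ ≤ f i + 2 ∧ f i + 2 ≤ hi + δ then (f i + 2).choose δ else 0) :=
    fun lo hi δ Θ h1 h2 => PLDClosure.shift11 s (fun i => x i + 1) (fun i => f i + 1) h11 lo hi δ Θ h1 h2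
  have h33 : ∀ lo hi δ Θ : ℕ, Θ ≤ lo + hi + δ → (lo = 0 ∨ lo + hi + δ ≤ Θ) →
      ∑ i ∈ s, (if lo ≤ x i + 3 ∧ x i + 3 ≤ hi ∧ Θ ≤ (f i + 3) + (x i + 3) then (f i + 3).choose δ else 0) ≤
        ∑ i ∈ s, (if lo + δ ≤ f i + 3 ∧ f i + 3 ≤ hi + δ then (f i + 3).choose δ else 0) :=
    fun lo hi δ Θ h1 h2 => PLDClosure.shift11 s (fun i => x i + 2) (fun i => f i + 2) h22 lo hi δ Θ h1 h2
  have hT : ∑ i ∈ s, ((if lo ≤ x i + 3 ∧ x i + 3 ≤ hi ∧ Θ ≤ (f i + 4) + (x i + 3) then (f i + 4).choose δ else 0) + (if lo ≤ x i + 4 ∧ x i + 4 ≤ hi ∧ Θ ≤ (f i + 3) + (x i + 4) then (f i + 3).choose δ else 0)) ≤ ∑ i ∈ s, ((if lo + δ ≤ f i + 4 ∧ f i + 4 ≤ hi + δ then (f i + 4).choose δ else 0) + (if lo + δ ≤ f i + 3 ∧ f i + 3 ≤ hi + δ then (f i + 3).choose δ else 0)) :=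
    PLDClosure.coloop s (fun i => x i + 3) (fun i => f i + 3) h33 lo hi δ Θ hΘ hlo
  have hS : ∑ i ∈ s, (if lo ≤ x i + 4 ∧ x i + 4 ≤ hi ∧ Θ ≤ (f i + 4) + (x i + 4) then (f i + 4).choose δ else 0) ≤ ∑ i ∈ s, (if lo + δ ≤ f i + 4 ∧ f i + 4 ≤ hi + δ then (f i + 4).choose δ else 0) :=
    PLDClosure.shift11 s (fun i => x i + 3) (fun i => f i + 3) h33 lo hi δ Θ hΘ hlo
  -- the nine layers, for `m` and for `7`
  have hLm : ∀ n : ℕ, 7 ≤ n → ∀ i ∈ s, ∑ j ∈ range (n + 1), Nat.choose n j *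
        (if lo ≤ x i + min j 4 ∧ x i + min j 4 ≤ hi ∧ Θ ≤ (f i + min (n - j) 4) + (x i + min j 4) then
          (f i + min (n - j) 4).choose δ else 0) =
      (if lo ≤ x i ∧ x i ≤ hi ∧ Θ ≤ (f i + 4) + x i then (f i + 4).choose δ else 0) + n * (if lo ≤ x i + 1 ∧ x i + 1 ≤ hi ∧ Θ ≤ (f i + 4) + (x i + 1) then (f i + 4).choose δ else 0) + n.choose 2 * (if lo ≤ x i + 2 ∧ x i + 2 ≤ hi ∧ Θ ≤ (f i + 4) + (x i + 2) then (f i + 4).choose δ else 0) + n.choose 3 * (if lo ≤ x i + 3 ∧ x i + 3 ≤ hi ∧ Θ ≤ (f i + 4) + (x i + 3) then (f i + 4).choose δ else 0) + (∑ i ∈ Ico 4 (n - 3), n.choose i) * (if lo ≤ x i + 4 ∧ x i + 4 ≤ hi ∧ Θ ≤ (f i + 4) + (x i + 4) then (f i + 4).choose δ else 0) + n.choose 3 * (if lo ≤ x i + 4 ∧ x i + 4 ≤ hi ∧ Θ ≤ (f i + 3) + (x i + 4) then (f i + 3).choose δ else 0) + n.choose 2 * (if lo ≤ x i + 4 ∧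 x i + 4 ≤ hi ∧ Θ ≤ (f i + 2) + (x i + 4) then (f i + 2).choose δ else 0) + n * (if lo ≤ x i + 4 ∧ x i + 4 ≤ hi ∧ Θ ≤ (f i + 1) + (x i + 4) then (f i + 1).choose δ else 0) + (if lo ≤ x i + 4 ∧ x i + 4 ≤ hi ∧ Θ ≤ f i + (x i + 4) then (f i).choose δ else 0) :=
    fun n hn i _ => PLDSolidLift.sum_choose_min_four n hn
      (fun a b => if lo ≤ x i + a ∧ x i + a ≤ hi ∧ Θ ≤ (f i + b) + (x i + a) then (f i + b).choose δ else 0)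
  have hRm : ∀ n : ℕ, 7 ≤ n → ∀ i ∈ s, ∑ j ∈ range (n + 1), Nat.choose n j *
        (if lo + δ ≤ f i + min (n - j) 4 ∧ f i + min (n - j) 4 ≤ hi + δ then (f i + min (n - j) 4).choose δ else 0) =
      (if lo + δ ≤ f i + 4 ∧ f i + 4 ≤ hi + δ then (f i + 4).choose δ else 0) + n * (if lo + δ ≤ f i + 4 ∧ f i + 4 ≤ hi + δ then (f i + 4).choose δ else 0) + n.choose 2 * (if lo + δ ≤ f i + 4 ∧ f i + 4 ≤ hi + δ then (f i + 4).choose δ else 0) + n.choose 3 * (if lo + δ ≤ f i + 4 ∧ f i + 4 ≤ hi + δ then (f i + 4).choose δ else 0) + (∑ i ∈ Ico 4 (n - 3), n.choose i) * (if lo + δ ≤ f i + 4 ∧ f i + 4 ≤ hi + δ then (f i + 4).choose δ else 0) + n.choose 3 * (if lo + δ ≤ f i + 3 ∧ f i + 3 ≤ hi + δ then (f i + 3).choose δ else 0) + n.choose 2 * (if lo + δ ≤ f i + 2 ∧ f i + 2 ≤ hi + δ then (f i + 2).choose δ else 0) + n * (if lo + δ ≤ f i + 1 ∧ f i + 1 ≤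 hi + δ then (f i + 1).choose δ else 0) + (if lo + δ ≤ f i ∧ f i ≤ hi + δ then (f i).choose δ else 0) :=
    fun n hn i _ => PLDSolidLift.sum_choose_min_four n hn
      (fun _ b => if lo + δ ≤ f i + b ∧ f i + b ≤ hi + δ then (f i + b).choose δ else 0)
  rw [sum_congr rfl (hLm m hm), sum_congr rfl (hRm m hm)]
  rw [sum_congr rfl (hLm 7 le_rfl), sum_congr rfl (hRm 7 le_rfl)] at h₀
  simp only [sum_add_distrib, ← mul_sum] at h₀ hq hq' ⊢
  rw [sum_add_distrib, sum_add_distrib] at hT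
  -- the coefficients
  obtain ⟨k, hk⟩ := Nat.exists_eq_add_of_le hm
  obtain ⟨k', hk'⟩ := Nat.exists_eq_add_of_le (PLDSolidLift.sum_choose_mid4_mono 7 m hm)
  have hC2 : 6 * m.choose 2 = 126 + 39 * k + 3 * k * k := by
    rw [hk, PLDSolidLift.six_mul_choose_two_sub 7 k (by norm_num), show 2 * 7 + k - 1 = 13 + k by omega]
    norm_num [Nat.choose]
    ring
  have hC3 : 6 * m.choose 3 = 210 + 107 * k + 18 * k * k + k * k * k := by
    have h := PLDSolidLift.six_mul_choose_three_sub 7 k (by norm_num)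
    rw [← hk] at h
    norm_num [Nat.choose] at h
    nlinarith [h]
  have h7c2 : Nat.choose 7 2 = 21 := by decide
  have h7c3 : Nat.choose 7 3 = 35 := by decide
  rw [h7c2, h7c3] at h₀
  rw [hk']
  rw [hk] at hC2 hC3 ⊢
  exact lift_alg_solid_small _ _ _ _ _ _ _ _ _ _ _ _ _ _ _ _ _ _ _ _ _ _ _ hC2 hC3 h₀ hq hq' hT hS


end PLDSolidLiftSmall

end PercRepro
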